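import Literature.Probability.Percolation.ZdFiveArmColumnDefs
import HarnessLib

/-!
# KSZ's uniqueness of the landed five-arm vertex, for bond percolation on `ℤ²`

Topic `Literature/Probability/Percolation`; PROOFS ONLY (one event definition, no named fact). The
deterministic half of the UPPER bound `α₅ ≤ 2` for the five-arm exponent, in the bond-`ℤ²`
rendering of the tree's `zdFiveArmClusters` (`ZdFourArmFromFiveArm.lean`) and of the named fact
`DuminilCopinManolescuTassion2021_zdFiveArm_upperBound` (`ZdFiveArmUpperBound.lean`): the
bond-`ℤ²` twin of `FiveArmUniqueness.lean` (site percolation on `𝕋`).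

H. Kesten, V. Sidoravicius, Y. Zhang, *Almost all words are seen in critical site percolation on
the triangular lattice*, EJP 3 (1998), proof of Lemma 5, (3.10)–(3.11): "`F(w, n)` [three
occupied paths from neighbours of `w` to the left and right edges of `S(n)`, two vacant ones to
the upper and lower edge] can occur for at most one `w ∈ S(n)` and consequently
`Σ_{w ∈ S(n/2)} P{w is occupied and F(w, n)} ≤ 1`."  P. Nolin, EJP 13 (2008), §5.2, proof of
Thm. 24, five-arm item [arXiv 0711.4948: Thm. 23 (iii), p. 17]: "We claim that `A_v` can occur for
at most one site `v` … Since `r₁ ∪ r₄ ∪ {v}` separates `I₃` from `I₅`, necessarily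
`w ∈ r₁ ∪ r₄ ∪ {v}` … the arm `r'₁ ∪ {w}` from `w` to `I₁` has to contain `v` … `v = w`.
Consequently `1 ≥ P_{1/2}(∪_v A_v) = Σ_v P_{1/2}(A_v)`."  D. Chelkak, H. Duminil-Copin,
C. Hongler, EJP 21 (2016), §5.2 (bond `ℤ²`, FK weight `q`; `q = 1` is Bernoulli): "the events
`A_x` are disjoint (topologically no two vertices in `Λ_N` can satisfy the events in question)".

## The bond rendering

In the rectangle `R = [0, M] × [0, N]` the event `zdFiveArmKSZ M N v` asks for three OPEN lattice
walks from the vertex `v` — one to the left side `{x₀ = 0}`, two to the right side `{x₀ = M}` —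
inside `R`, pairwise vertex-disjoint off `v` (KSZ's three occupied paths), and for ONE walk of
faces of the dual rectangle `R* = [0, M-1] × [-1, N]` (lower-left corners, face adjacency = lattice
adjacency, as in `PlanarDuality.lean`) from the top face row `{x₁ = N}` to the bottom face row
`{x₁ = -1}`, every step of which crosses a CLOSED primal edge except possibly the steps between
two of the four faces around `v` (`cornerFaces v`), which cross edges incident to `v`: this single
walk is KSZ's pair of vacant paths to the upper and lower edges, joined through `v`.

## Contents

* `cornerFaces v`, `mem_sepEdge_of_cornerFaces` — a step between two faces around `v` crosses an
  edge incident to `v`;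
* `zdFiveArmKSZ M N v` (DEFINITION of the event), `zdFiveArmKSZ_subset_lrCrossing` (sanity: it is a
  sub-event of `lrCrossing M N`) and `ZdFiveArmKSZ.mem_support_of_dual` — the engine: an open left–right walk of `R` contains the centre `w` of any such dual walk (the tree's
  discrete Jordan lemma `exists_dart_sepEdge_mem_edges`: the two walks cross at an edge; the edge is
  open, so the crossing step is a corner step of `w`);
* `zdFiveArmKSZ_unique` — **the event occurs for at most one vertex** (Nolin's two steps: the
  centre `w` lies on `r₁ v r₃` and on `r₁ v r₄`, hence on `r₁` since `r₃ ∩ r₄ = {v}`; then `v` lies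
  on `r₁[w →] w r'₃` and on `r₁[w →] w r'₄`, i.e. on `r'₃ ∩ r'₄ = {w}`), `pairwise_disjoint_zdFiveArmKSZ`;
* `determinedBy_zdFiveArmKSZ`, `measurableSet_zdFiveArmKSZ`, `sum_real_zdFiveArmKSZ_le_one` —
  **`Σ_{v ∈ V} μ(zdFiveArmKSZ M N v) ≤ 1`** for every probability measure `μ` (KSZ's (3.11),
  Nolin's display), at every density.

What is NOT here (the other half of the printed upper bound `N² P(0 ⇝⁵ ∂S_N) ≤ C`): the
comparison `P(zdFiveArmKSZ (2N) (2N) v) ≥ c · P(zdFiveArmClusters k N)` uniformly in the centre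
`v` of the middle box (KSZ (3.12) and the Appendix to Lemma 5; Nolin Thm. 11 and Prop. 12: arm
separation and extension for five arms), absent from the tree for bond `ℤ²`.

## References

* H. Kesten, V. Sidoravicius, Y. Zhang, EJP 3 (1998), paper 10, proof of Lemma 5, (3.10)–(3.11)
  [KestenSidoraviciusZhang1998].
* P. Nolin, EJP 13 (2008) 1562–1623, §5.2, proof of Thm. 24 (arXiv 0711.4948: Thm. 23 (iii), p. 17)
  [Nolin2008].
* D. Chelkak, H. Duminil-Copin, C. Hongler, EJP 21 (2016), paper 5, §5.2, proof of Cor. 1.5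
  [ChelkakDuminilCopinHongler2016].
* B. Bollobás, O. Riordan, *Percolation* (2006), Ch. 3, Lemma 1 (crossings of a rectangle and of its
  dual cross at an edge) [BollobasRiordan2006].

Tree: `exists_dart_sepEdge_mem_edges`, `sepEdge`, `sepLo`, `sepHi` (`PlanarDuality.lean`),
`ZdDual.sep_cases` (`ZdFiveArmColumnDefs.lean`), `rectangle`, `mem_rectangle_iff` (`Crossings.lean`),
`DeterminedBy`, `determinedBy_iff`, `DeterminedBy.measurableSet_of_finset` (`PercolationEvents.lean`).
Mathlib: `SimpleGraph.Walk.bypass`, `takeUntil`/`dropUntil`, `measureReal_biUnion_finset`.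
-/

noncomputable section

open Set MeasureTheory SimpleGraph

namespace Literature.Probability.Percolation

open LatticeModels

/-! ### The four faces around a vertex -/

/-- **The four faces around the vertex `v`** (lower-left corners `v`, `v - e₀`, `v - e₁`,
`v - e₀ - e₁`), in coordinates: the faces whose closure contains `v`. In KSZ's `F(w, n)` the two
vacant paths start "from neighbors of `w`"; in the bond rendering the two dual arms start from these
faces. [cite: KestenSidoraviciusZhang1998, proof of Lemma 5, (3.10)] -/
def cornerFaces (v : Site 2) : Set (Site 2) :=
  {z | (z 0 = v 0 ∨ z 0 + 1 = v 0) ∧ (z 1 = v 1 ∨ z 1 + 1 = v 1)}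

/-- Membership in `cornerFaces v`, in coordinates. [folklore] -/
theorem mem_cornerFaces_iff {v z : Site 2} :
    z ∈ cornerFaces v ↔ (z 0 = v 0 ∨ z 0 + 1 = v 0) ∧ (z 1 = v 1 ∨ z 1 + 1 = v 1) := Iff.rfl

/-- **A step between two faces around `v` crosses an edge incident to `v`**: for lattice-adjacent
faces `z, z' ∈ cornerFaces v`, the vertex `v` is an endpoint of the separating primal edge
`sepEdge z z'` (the four such edges are the four edges at `v`). [folklore] -/
theorem mem_sepEdge_of_cornerFaces {v z z' : Site 2} (hz : z ∈ cornerFaces v)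
    (hz' : z' ∈ cornerFaces v) (h : (zdGraph 2).Adj z z') : v ∈ sepEdge z z' := by
  rw [sepEdge, Sym2.mem_iff]
  obtain ⟨hz0, hz1⟩ := hz
  obtain ⟨hz0', hz1'⟩ := hz'
  rcases ZdDual.sep_cases h with ⟨h0, h1, hlo0, hlo1, hhi0, hhi1⟩ | ⟨h0, h1, hlo0, hlo1, hhi0, hhi1⟩ |
      ⟨h1, h0, hlo0, hlo1, hhi0, hhi1⟩ | ⟨h1, h0, hlo0, hlo1, hhi0, hhi1⟩
  all_goals
    simp only [LatticeModels.Site.eq_iff_two, hlo0, hlo1, hhi0, hhi1]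
    omega

/-! ### KSZ's landed five-arm event, bond form -/

/-- **KSZ's event `{w occupied} ∩ F(w, n)`, bond-`ℤ²` form, in the rectangle
`R = [0, M] × [0, N]`** (KSZ 1998, (3.10): "there exist 5 disjoint paths on `𝕋` from neighbors
of `w` to `∂S(n)`; three of these are occupied and have their endpoint on the left [and right]
edge of `S(n)`; the two remaining paths are vacant and have their endpoint on the upper edge and
lower edge of `S(n)`, respectively"; Nolin 2008, proof of Thm. 24: `A_v := {v ⇝^I_{5,σ} ∂S_N}`,
`σ = BWBBW`, with the landing sequence of his figure).  At the vertex `v`: three OPEN lattice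
walks from `v` inside `R`, the first to the left side `{x₀ = 0}`, the other two to the right side
`{x₀ = M}`, pairwise vertex-disjoint off `v`; and a walk of faces of the dual rectangle
`[0, M-1] × [-1, N]` from the top face row `{x₁ = N}` to the bottom face row `{x₁ = -1}` whose
steps cross CLOSED primal edges, except possibly for steps between two faces around `v` (the two
dual arms to the top and to the bottom, joined through `v`). [cite: KestenSidoraviciusZhang1998, proof of Lemma 5, (3.10)] [cite: Nolin2008, §5.2, proof of Thm. 24 (arXiv 0711.4948: p. 16, the event A_v)] -/
def zdFiveArmKSZ (M N : ℕ) (v : Site 2) : Set (BondConfig (Site 2)) :=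
  {ω | ∃ (l r r' : Site 2) (P₁ : (zdGraph 2).Walk v l) (P₃ : (zdGraph 2).Walk v r)
      (P₄ : (zdGraph 2).Walk v r'),
    l 0 = 0 ∧ r 0 = M ∧ r' 0 = M ∧
    (∀ z ∈ P₁.support, (0 : ℤ) ≤ z 0 ∧ z 0 ≤ M ∧ (0 : ℤ) ≤ z 1 ∧ z 1 ≤ N) ∧
    (∀ z ∈ P₃.support, (0 : ℤ) ≤ z 0 ∧ z 0 ≤ M ∧ (0 : ℤ) ≤ z 1 ∧ z 1 ≤ N) ∧
    (∀ z ∈ P₄.support, (0 : ℤ) ≤ z 0 ∧ z 0 ≤ M ∧ (0 : ℤ) ≤ z 1 ∧ z 1 ≤ N) ∧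
    (∀ e ∈ P₁.edges, e ∈ ω) ∧ (∀ e ∈ P₃.edges, e ∈ ω) ∧ (∀ e ∈ P₄.edges, e ∈ ω) ∧
    (∀ z ∈ P₁.support, z ∈ P₃.support → z = v) ∧ (∀ z ∈ P₁.support, z ∈ P₄.support → z = v) ∧
    (∀ z ∈ P₃.support, z ∈ P₄.support → z = v) ∧
    ∃ (t s : Site 2) (Q : (zdGraph 2).Walk t s), t 1 = N ∧ s 1 = -1 ∧
      (∀ z ∈ Q.support, (0 : ℤ) ≤ z 0 ∧ z 0 + 1 ≤ M ∧ (-1 : ℤ) ≤ z 1 ∧ z 1 ≤ N) ∧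
      ∀ d ∈ Q.darts, sepEdge d.fst d.snd ∉ ω ∨ (d.fst ∈ cornerFaces v ∧ d.snd ∈ cornerFaces v)}

/-- Sanity check: the landed five-arm event is a sub-event of the left–right open crossing of
`R` (the first and second open arms form an open crossing through `v`). [cite: KestenSidoraviciusZhang1998, proof of Lemma 5, (3.10)] -/
theorem zdFiveArmKSZ_subset_lrCrossing (M N : ℕ) (v : Site 2) :
    zdFiveArmKSZ M N v ⊆ lrCrossing M N := by
  rintro ω ⟨l, r, r', P₁, P₃, P₄, hl, hr, -, hs₁, hs₃, -, he₁, he₃, -, -⟩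
  have hl' := hs₁ l P₁.end_mem_support
  have hr' := hs₃ r P₃.end_mem_support
  refine ⟨l, ?_, r, ?_, mem_openConnIn_of_walk (P₁.reverse.append P₃) ?_ ?_⟩
  · simp only [Finset.mem_coe, leftSide, Finset.mem_filter, mem_rectangle_iff]
    exact ⟨hl', hl⟩
  · simp only [Finset.mem_coe, rightSide, Finset.mem_filter, mem_rectangle_iff]
    exact ⟨hr', hr⟩
  · intro z hz
    rw [Walk.mem_support_append_iff, Walk.support_reverse, List.mem_reverse] at hz
    simp only [Finset.mem_coe, mem_rectangle_iff]
    rcases hz with hz | hz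
    exacts [hs₁ z hz, hs₃ z hz]
  · intro e he
    rw [Walk.edges_append, List.mem_append, Walk.edges_reverse, List.mem_reverse] at he
    rcases he with he | he
    exacts [he₁ e he, he₃ e he]

/-- **The engine: an open left–right walk of `R` passes through the centre of the dual walk.**
If `A` is a lattice walk inside `R = [0, M] × [0, N]` from the left side to the right side whose
edges are open, and `Q` is a face walk of the dual rectangle from the top row to the bottom row
whose steps cross closed edges except for corner steps of `w`, then `w ∈ A` — by the discrete
Jordan lemma `exists_dart_sepEdge_mem_edges` the two cross at an edge of `A`, which is open, so
the crossing step is a corner step of `w` and the crossed edge is incident to `w` (Nolin: "since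
`r₁ ∪ r₄ ∪ {v}` separates `I₃` from `I₅`, necessarily `w ∈ r₁ ∪ r₄ ∪ {v}`").
[cite: Nolin2008, §5.2, proof of Thm. 24 (arXiv 0711.4948: p. 17)] [cite: BollobasRiordan2006, Ch. 3, Lemma 1] -/
theorem ZdFiveArmKSZ.mem_support_of_dual {M N : ℕ} {ω : BondConfig (Site 2)} {w l r t s : Site 2}
    (A : (zdGraph 2).Walk l r)
    (hA : ∀ z ∈ A.support, (0 : ℤ) ≤ z 0 ∧ z 0 ≤ M ∧ (0 : ℤ) ≤ z 1 ∧ z 1 ≤ N)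
    (hl : l 0 = 0) (hr : r 0 = M) (hAω : ∀ e ∈ A.edges, e ∈ ω) (Q : (zdGraph 2).Walk t s)
    (hQ : ∀ z ∈ Q.support, (0 : ℤ) ≤ z 0 ∧ z 0 + 1 ≤ M ∧ (-1 : ℤ) ≤ z 1 ∧ z 1 ≤ N)
    (ht : t 1 = N) (hs : s 1 = -1)
    (hQω : ∀ d ∈ Q.darts, sepEdge d.fst d.snd ∉ ω ∨ (d.fst ∈ cornerFaces w ∧ d.snd ∈ cornerFaces w)) :
    w ∈ A.support := by
  obtain ⟨d, hd, he⟩ := exists_dart_sepEdge_mem_edges A Q hA hQ hl hr ht hs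
  rcases hQω d hd with hcl | ⟨h1, h2⟩
  · exact absurd (hAω _ he) hcl
  · have hv := mem_sepEdge_of_cornerFaces h1 h2 d.adj
    rw [sepEdge, Sym2.mem_iff] at hv
    rw [sepEdge] at he
    rcases hv with h | h
    · rw [h]; exact A.fst_mem_support_of_mem_edges he
    · rw [h]; exact A.snd_mem_support_of_mem_edges he

/-- On a path from `v`, the final piece after a vertex `w ≠ v` avoids `v`. [folklore] -/
theorem ZdFiveArmKSZ.not_mem_support_dropUntil {v l w : Site 2} {P : (zdGraph 2).Walk v l}
    (hP : P.IsPath) (hw : w ∈ P.support) (hne : v ≠ w) : v ∉ (P.dropUntil w hw).support := by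
  intro hv
  have hnd : ((P.takeUntil w hw).append (P.dropUntil w hw)).support.Nodup := by
    rw [P.take_spec hw]; exact hP.support_nodup
  rw [Walk.support_append] at hnd
  rcases (Walk.mem_support_iff _).1 hv with h | h
  · exact hne h
  · exact List.disjoint_of_nodup_append hnd (Walk.start_mem_support _) h

/-- **KSZ / Nolin uniqueness, bond `ℤ²`: the landed five-arm event occurs for at most one
vertex.**  If `zdFiveArmKSZ M N v` and `zdFiveArmKSZ M N w` both hold in `ω` then `v = w`.
Proof (Nolin 2008, p. 17, with edges for sites): (1) the open walks `r₁ v r₃` and `r₁ v r₄` of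
`v` (after making `r₁` a path) both contain `w` (`ZdFiveArmKSZ.mem_support_of_dual` with the dual
walk of `w`); `r₃ ∩ r₄ = {v}` and `w ≠ v` force `w ∈ r₁`; (2) the open walks
`(r₁ from w to the left side) w r'₃` and `… w r'₄` both contain `v` (the same lemma with the dual
walk of `v`); the piece of the path `r₁` after `w` avoids `v`, so `v ∈ r'₃ ∩ r'₄ = {w}`,
contradiction.  Only the disjointness of the two right arms is used. [cite: Nolin2008, §5.2, proof of Thm. 24 (arXiv 0711.4948: Thm. 23 (iii), p. 17)] [cite: KestenSidoraviciusZhang1998, proof of Lemma 5, (3.10)-(3.11)] -/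
theorem zdFiveArmKSZ_unique {M N : ℕ} {ω : BondConfig (Site 2)} {v w : Site 2}
    (hv : ω ∈ zdFiveArmKSZ M N v) (hw : ω ∈ zdFiveArmKSZ M N w) : v = w := by
  classical
  by_contra hne
  obtain ⟨l, r, r', P₁, P₃, P₄, hl, hr, hr', hs₁, hs₃, hs₄, he₁, he₃, he₄, -, -, h₃₄, t, s, Q, ht,
    hs, hQs, hQd⟩ := hv
  obtain ⟨l', q, q', P₁', P₃', P₄', -, hq, hq', -, hs₃', hs₄', -, he₃', he₄', -, -, h₃₄', t', s',
    Q', ht', hs', hQs', hQd'⟩ := hw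
  -- make the left arm of `v` a path
  set P₁b := P₁.bypass with hP₁b
  have hbS : ∀ z ∈ P₁b.support, z ∈ P₁.support := fun z hz => P₁.support_bypass_subset_support hz
  have hbE : ∀ e ∈ P₁b.edges, e ∈ P₁.edges := fun e he => P₁.edges_bypass_subset_edges he
  -- step (1): `w` lies on `r₁ v r₃` and on `r₁ v r₄`
  have step1 : ∀ {x : Site 2} (P : (zdGraph 2).Walk v x), x 0 = M →
      (∀ z ∈ P.support, (0 : ℤ) ≤ z 0 ∧ z 0 ≤ M ∧ (0 : ℤ) ≤ z 1 ∧ z 1 ≤ N) →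
      (∀ e ∈ P.edges, e ∈ ω) → w ∈ P₁b.support ∨ w ∈ P.support := by
    intro x P hx hPs hPe
    have hmem := ZdFiveArmKSZ.mem_support_of_dual (w := w) (P₁b.reverse.append P) ?_ hl hx ?_ Q'
      hQs' ht' hs' hQd'
    · rwa [Walk.mem_support_append_iff, Walk.support_reverse, List.mem_reverse] at hmem
    · intro z hz
      rw [Walk.mem_support_append_iff, Walk.support_reverse, List.mem_reverse] at hz
      rcases hz with hz | hz
      · exact hs₁ z (hbS z hz)
      · exact hPs z hz
    · intro e he
      rw [Walk.edges_append, List.mem_append, Walk.edges_reverse, List.mem_reverse] at he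
      rcases he with he | he
      · exact he₁ e (hbE e he)
      · exact hPe e he
  have hw₁ : w ∈ P₁b.support := by
    rcases step1 P₃ hr hs₃ he₃ with h | h3
    · exact h
    rcases step1 P₄ hr' hs₄ he₄ with h | h4
    · exact h
    exact absurd (h₃₄ w h3 h4).symm hne
  -- step (2): the piece of `r₁` beyond `w` avoids `v`
  set S := P₁b.dropUntil w hw₁ with hS
  have hvS : v ∉ S.support := ZdFiveArmKSZ.not_mem_support_dropUntil (P₁.bypass_isPath) hw₁ hne
  have hSs : ∀ z ∈ S.support, z ∈ P₁.support := fun z hz =>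
    hbS z (P₁b.support_dropUntil_subset_support hw₁ hz)
  have hSe : ∀ e ∈ S.edges, e ∈ P₁.edges := fun e he =>
    hbE e (P₁b.edges_dropUntil_subset_edges hw₁ he)
  have step2 : ∀ {x : Site 2} (P : (zdGraph 2).Walk w x), x 0 = M →
      (∀ z ∈ P.support, (0 : ℤ) ≤ z 0 ∧ z 0 ≤ M ∧ (0 : ℤ) ≤ z 1 ∧ z 1 ≤ N) →
      (∀ e ∈ P.edges, e ∈ ω) → v ∈ P.support := by
    intro x P hx hPs hPe
    have hmem := ZdFiveArmKSZ.mem_support_of_dual (w := v) (S.reverse.append P) ?_ hl hx ?_ Q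
      hQs ht hs hQd
    · rw [Walk.mem_support_append_iff, Walk.support_reverse, List.mem_reverse] at hmem
      exact hmem.resolve_left hvS
    · intro z hz
      rw [Walk.mem_support_append_iff, Walk.support_reverse, List.mem_reverse] at hz
      rcases hz with hz | hz
      · exact hs₁ z (hSs z hz)
      · exact hPs z hz
    · intro e he
      rw [Walk.edges_append, List.mem_append, Walk.edges_reverse, List.mem_reverse] at he
      rcases he with he | he
      · exact he₁ e (hSe e he)
      · exact hPe e he
  exact hne (h₃₄' v (step2 P₃' hq hs₃' he₃') (step2 P₄' hq' hs₄' he₄'))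

/-- The events `zdFiveArmKSZ M N v`, `v` ranging over the vertices, are pairwise disjoint.
[cite: Nolin2008, §5.2, proof of Thm. 24 (arXiv 0711.4948: p. 17)] -/
theorem pairwise_disjoint_zdFiveArmKSZ (M N : ℕ) {v w : Site 2} (hvw : v ≠ w) :
    Disjoint (zdFiveArmKSZ M N v) (zdFiveArmKSZ M N w) :=
  Set.disjoint_left.2 fun _ hv hw => hvw (zdFiveArmKSZ_unique hv hw)

/-! ### Measurability and the sum over the centres -/

/-- The pairs of sites of the enlarged rectangle `[0, M] × [-1, N + 1]`: the coordinates read by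
`zdFiveArmKSZ M N v` (the edges of the open walks lie in `R`; the edge crossed by a step of the
dual walk has endpoints with `x₀ ∈ [0, M]` and `x₁ ∈ [-1, N + 1]`). [folklore] -/
def ZdFiveArmKSZ.readPairs (M N : ℕ) : Finset (Sym2 (Site 2)) :=
  (Finset.Icc ![(0 : ℤ), -1] ![(M : ℤ), (N : ℤ) + 1]).sym2

/-- Membership in the enlarged rectangle, in coordinates. [folklore] -/
theorem ZdFiveArmKSZ.mem_Icc_iff {M N : ℕ} {x : Site 2} :
    x ∈ Finset.Icc ![(0 : ℤ), -1] ![(M : ℤ), (N : ℤ) + 1] ↔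
      0 ≤ x 0 ∧ x 0 ≤ M ∧ -1 ≤ x 1 ∧ x 1 ≤ (N : ℤ) + 1 := by
  simp only [Finset.mem_Icc, Pi.le_def, Fin.forall_fin_two, Matrix.cons_val_zero, Matrix.cons_val_one]
  tauto

/-- The edge crossed by a step of a face walk of the dual rectangle is a pair of the enlarged
rectangle. [folklore] -/
theorem ZdFiveArmKSZ.sepEdge_mem_readPairs {M N : ℕ} {z z' : Site 2} (h : (zdGraph 2).Adj z z')
    (hz : (0 : ℤ) ≤ z 0 ∧ z 0 + 1 ≤ M ∧ (-1 : ℤ) ≤ z 1 ∧ z 1 ≤ N)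
    (hz' : (0 : ℤ) ≤ z' 0 ∧ z' 0 + 1 ≤ M ∧ (-1 : ℤ) ≤ z' 1 ∧ z' 1 ≤ N) :
    sepEdge z z' ∈ ZdFiveArmKSZ.readPairs M N := by
  rw [ZdFiveArmKSZ.readPairs, sepEdge, Finset.mk_mem_sym2_iff, ZdFiveArmKSZ.mem_Icc_iff,
    ZdFiveArmKSZ.mem_Icc_iff]
  rcases ZdDual.sep_cases h with ⟨h0, h1, hlo0, hlo1, hhi0, hhi1⟩ | ⟨h0, h1, hlo0, hlo1, hhi0, hhi1⟩ |
      ⟨h1, h0, hlo0, hlo1, hhi0, hhi1⟩ | ⟨h1, h0, hlo0, hlo1, hhi0, hhi1⟩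
  all_goals
    rw [hlo0, hlo1, hhi0, hhi1]
    omega

/-- An edge of a lattice walk inside `R` is a pair of the enlarged rectangle. [folklore] -/
theorem ZdFiveArmKSZ.edge_mem_readPairs {M N : ℕ} {a b : Site 2} (P : (zdGraph 2).Walk a b)
    (hP : ∀ z ∈ P.support, (0 : ℤ) ≤ z 0 ∧ z 0 ≤ M ∧ (0 : ℤ) ≤ z 1 ∧ z 1 ≤ N) {e : Sym2 (Site 2)}
    (he : e ∈ P.edges) : e ∈ ZdFiveArmKSZ.readPairs M N := by
  rw [Walk.edges, List.mem_map] at he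
  obtain ⟨d, hd, rfl⟩ := he
  have h1 := hP _ (P.dart_fst_mem_support_of_mem_darts hd)
  have h2 := hP _ (P.dart_snd_mem_support_of_mem_darts hd)
  rw [ZdFiveArmKSZ.readPairs, Dart.edge, Finset.mk_mem_sym2_iff, ZdFiveArmKSZ.mem_Icc_iff,
    ZdFiveArmKSZ.mem_Icc_iff]
  omega

/-- **`zdFiveArmKSZ M N v` depends only on the pairs of the enlarged rectangle.** [folklore] -/
theorem determinedBy_zdFiveArmKSZ (M N : ℕ) (v : Site 2) :
    DeterminedBy (zdFiveArmKSZ M N v) ↑(ZdFiveArmKSZ.readPairs M N) := by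
  set F := ZdFiveArmKSZ.readPairs M N with hF
  suffices key : ∀ ω ω' : BondConfig (Site 2), ω ∩ ↑F = ω' ∩ ↑F →
      ω ∈ zdFiveArmKSZ M N v → ω' ∈ zdFiveArmKSZ M N v by
    rw [determinedBy_iff]
    exact fun ω ω' h => ⟨key ω ω' h, key ω' ω h.symm⟩
  rintro ω ω' h ⟨l, r, r', P₁, P₃, P₄, hl, hr, hr', hs₁, hs₃, hs₄, he₁, he₃, he₄, h₁₃, h₁₄, h₃₄, t, s,
    Q, ht, hs, hQs, hQd⟩
  have agree : ∀ e ∈ F, e ∈ ω ↔ e ∈ ω' := fun e he => by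
    constructor
    · intro heω; exact ((Set.ext_iff.1 h e).1 ⟨heω, he⟩).1
    · intro heω; exact ((Set.ext_iff.1 h e).2 ⟨heω, he⟩).1
  refine ⟨l, r, r', P₁, P₃, P₄, hl, hr, hr', hs₁, hs₃, hs₄,
    fun e he => (agree e (ZdFiveArmKSZ.edge_mem_readPairs P₁ hs₁ he)).1 (he₁ e he),
    fun e he => (agree e (ZdFiveArmKSZ.edge_mem_readPairs P₃ hs₃ he)).1 (he₃ e he),
    fun e he => (agree e (ZdFiveArmKSZ.edge_mem_readPairs P₄ hs₄ he)).1 (he₄ e he),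
    h₁₃, h₁₄, h₃₄, t, s, Q, ht, hs, hQs, fun d hd => ?_⟩
  rcases hQd d hd with hcl | hc
  · refine Or.inl fun he' => hcl ((agree _ ?_).2 he')
    exact ZdFiveArmKSZ.sepEdge_mem_readPairs d.adj (hQs _ (Q.dart_fst_mem_support_of_mem_darts hd))
      (hQs _ (Q.dart_snd_mem_support_of_mem_darts hd))
  · exact Or.inr hc

/-- The landed five-arm event is measurable. [folklore] -/
theorem measurableSet_zdFiveArmKSZ (M N : ℕ) (v : Site 2) : MeasurableSet (zdFiveArmKSZ M N v) :=
  (determinedBy_zdFiveArmKSZ M N v).measurableSet_of_finset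

/-- **`Σ_v P(A_v) ≤ 1`, bond `ℤ²`** (KSZ 1998, (3.11): "`Σ_{w ∈ S(n/2)} P{w is occupied and
F(w, n)} ≤ 1`"; Nolin 2008, proof of Thm. 24: "`1 ≥ P_{1/2}(∪_v A_v) = Σ_v P_{1/2}(A_v)`"): for
every probability measure `μ` on bond configurations and every finite set `V` of vertices,
`Σ_{v ∈ V} μ(zdFiveArmKSZ M N v) ≤ 1` — the events are measurable and pairwise disjoint.  No
symmetry of `μ` is used (every density `p`). [cite: KestenSidoraviciusZhang1998, proof of Lemma 5, (3.11)] [cite: Nolin2008, §5.2, proof of Thm. 24 (arXiv 0711.4948: p. 17, first display)] -/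
theorem sum_real_zdFiveArmKSZ_le_one (μ : Measure (BondConfig (Site 2))) [IsProbabilityMeasure μ]
    (M N : ℕ) (V : Finset (Site 2)) :
    ∑ v ∈ V, μ.real (zdFiveArmKSZ M N v) ≤ 1 := by
  rw [← measureReal_biUnion_finset (fun v _ w _ hvw => pairwise_disjoint_zdFiveArmKSZ M N hvw)
    (fun v _ => measurableSet_zdFiveArmKSZ M N v)]
  exact measureReal_le_one

end Literature.Probability.Percolation

end
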